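import Mathlib
import HarnessLib
import Summits.QuantumFields.YangMills.Theorems.HypercubicLimit.Negative.ReflectedDensity
import Summits.QuantumFields.YangMills.Theorems.FradkinShenkerFlowFiniteSusceptibilityWeakCouplingRPCauchySchwarz
import Summits.QuantumFields.YangMills.Theorems.LangevinControlUVOSLegsFromFemtoAndGapStubAssemblyLatticeDist
import Summits.QuantumFields.YangMills.Theorems.LangevinControlUVOSLegsFromFemtoAndGapStubAssemblyShiftDefect
import Summits.QuantumFields.YangMills.Theorems.LangevinControlUVOSLegsFromFemtoAndGapStubUpgrade
import Summits.QuantumFields.YangMills.Theorems.PencilRigidityHypercubicLimitRpBlockHermitian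
import Literature.MathematicalPhysics.AQFT.OSAxiomsSchwinger
import Literature.MathematicalPhysics.QuantumFieldTheory.OSData
import Literature.MathematicalPhysics.QuantumLattice.LatticeScalarField
import Literature.MathematicalPhysics.QuantumLattice.SchwartzNuclearExpansionBounds
import Literature.MathematicalPhysics.QuantumFieldTheory.LatticeGaugeStaticPotentialProofs
import Literature.Probability.LatticeModels.ThermodynamicLimit

/-!
# `HypercubicLimit`, line `conditional-mean-telescoping` (c1 blocks, wave 4): stub `rpBlock_thetaInvariance`

Support file (`--supports stmt-QuantumFields-8646`) for crux
`Summit.QuantumFields.YangMills.Theses.PencilRigidity.HypercubicLimit`, line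
`conditional-mean-telescoping`: the registered c1 block `rpBlock_thetaInvariance` — **exact
time-reflection invariance of the RP-adapted lattice family**.

The RP-adapted lattice `n`-point functional is the finite sum
`S_n F = ∑_q ∑_{x ∈ D_q} λⁿ W_q(x) F(pt_q(x))` over plaquette strings (orientations `q k = (i<j)`,
corners `x k ∈ ℤ⁴`; temporal corners range over `box 4 L`, spatial ones over the time slab `[1-L, L]`
of the box), with real weights `W_q(x)` (centred torus plaquette moments in Wilson's state on the odd
torus of side `2L+1`) and plaquette centres `pt_q(x)`.  We show `S_n (Θ F) = S_n F` for EVERY test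
function `F`, `(Θ F)(y) = F(θ y₁, …, θ yₙ)` (`thetaMulti_apply`).

Route (reusing the public helpers of the landed hermiticity block,
`Theorems/PencilRigidityHypercubicLimitRpBlockHermitian.lean`): expand the functional; for each string
of orientations `q` reindex every corner by the corner reflection `R_q` (temporal `y₀ ↦ -y₀` on the box,
spatial `y₀ ↦ 1 - y₀` on the slab; `herm_sum_reindex_corner`, `herm_corner_mem`, `herm_corner_inv`);
then `θ (pt_q (R_q y)) = pt_q y` (`herm_point_reflect`) and the moment identity `W_q(R ∘ x) = W_q(x)`
(`herm_moment_corner`, i.e. `Θ`-invariance of Wilson's torus state).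
-/

noncomputable section

open scoped SchwartzMap ComplexConjugate
open MeasureTheory Filter Topology
open Literature.MathematicalPhysics.AQFT Literature.MathematicalPhysics.QuantumLattice
open Literature.MathematicalPhysics.QuantumFieldTheory
open Literature.Probability.LatticeModels (box Site)
open Summit.QuantumFields.YangMills.Theorems.HypercubicLimit.Negative (torusPlaquette thetaZ)
open Summit.QuantumFields.YangMills.Theorems.OSLegsFromFemtoAndGap (latticeDist torusMoment)

namespace Summit.QuantumFields.YangMills.Cruxes.HypercubicLimit.ConditionalMeanTelescoping

/-- Summand-level identity after the corner reindexing: the reindexed weight times `F` at the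
reflected reindexed centres is the original weight times `F` at the original centres
(`herm_point_reflect`, `herm_moment_corner`). [folklore] -/
theorem thetaI_summand {G : Type} [Group G] [TopologicalSpace G] [IsTopologicalGroup G]
    [CompactSpace G] [MeasurableSpace G] [BorelSpace G] (r : LatticeRep G) (β : ℝ) (L : ℕ)
    (a lam : ℝ) (m : {q : Fin 4 × Fin 4 // q.1 < q.2} → ℝ) {n : ℕ}
    (F : (Fin n → EuclideanSpace ℝ (Fin 4)) → ℂ)
    (q : Fin n → {q : Fin 4 × Fin 4 // q.1 < q.2}) (x : Fin n → (Fin 4 → ℤ)) :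
    (((lam ^ n * ∫ U, ∏ k, (torusPlaquette r (2 * L + 1) (q k).1.1 (q k).1.2
        (if (q k).1.1 = 0 then thetaZ (x k) - Pi.single 0 1 else thetaZ (x k)) U - m (q k))
        ∂(wilsonMeasure r.ρ β : Measure (GaugeConfig 4 (2 * L + 1) G)) : ℝ) : ℂ)) *
      F (fun k => timeReflection 4 (a • (siteToE
        (if (q k).1.1 = 0 then thetaZ (x k) - Pi.single 0 1 else thetaZ (x k)) +
        (2⁻¹ : ℝ) • (EuclideanSpace.single (q k).1.1 (1 : ℝ) + EuclideanSpace.single (q k).1.2 (1 : ℝ)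
          - EuclideanSpace.single 0 (1 : ℝ))))) =
    (((lam ^ n * ∫ U, ∏ k, (torusPlaquette r (2 * L + 1) (q k).1.1 (q k).1.2 (x k) U - m (q k))
        ∂(wilsonMeasure r.ρ β : Measure (GaugeConfig 4 (2 * L + 1) G)) : ℝ) : ℂ)) *
      F (fun k => a • (siteToE (x k) +
        (2⁻¹ : ℝ) • (EuclideanSpace.single (q k).1.1 (1 : ℝ) + EuclideanSpace.single (q k).1.2 (1 : ℝ)
          - EuclideanSpace.single 0 (1 : ℝ)))) := by
  simp only [herm_point_reflect, herm_moment_corner]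

/-- **Block Θ-INV (exact time-reflection invariance of the RP-adapted family).** For every test function
`F` (off-diagonal or not) the RP-adapted lattice `n`-point functional takes the same value on `F` and on
`Θ F` (`thetaMulti 4 F`, `(ΘF)(y) = F(θ y₁, …, θ yₙ)`): corner-reflection reindexing
(`rpBlock_reflectSum`) + Θ-invariance of the torus state (`herm_moment_corner`). -/
theorem rpBlock_thetaInvariance :
    ∀ (G : Type) [Group G] [TopologicalSpace G] [IsTopologicalGroup G] [CompactSpace G]
      [MeasurableSpace G] [BorelSpace G] (r : LatticeRep G) (β : ℝ) (L : ℕ) (a lam : ℝ)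
      (m : {q : Fin 4 × Fin 4 // q.1 < q.2} → ℝ) (n : ℕ) (F : 𝓢((Fin n → EuclideanSpace ℝ (Fin 4)), ℂ)),
      (∑ q : Fin n → {q : Fin 4 × Fin 4 // q.1 < q.2},
          ∑ x ∈ Fintype.piFinset (fun k => if (q k).1.1 = 0 then box 4 L
              else (box 4 L).filter (fun y => 1 - (L : ℤ) ≤ y 0)),
            (((lam ^ n * ∫ U, ∏ k, (torusPlaquette r (2 * L + 1) (q k).1.1 (q k).1.2 (x k) U - m (q k))
                ∂(wilsonMeasure r.ρ β : Measure (GaugeConfig 4 (2 * L + 1) G)) : ℝ) : ℂ)) •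
              LabelledSchwingerFamily.evalAt (fun k => a • (siteToE (x k) +
                (2⁻¹ : ℝ) • (EuclideanSpace.single (q k).1.1 (1 : ℝ) + EuclideanSpace.single (q k).1.2 (1 : ℝ)
                  - EuclideanSpace.single 0 (1 : ℝ))))) (thetaMulti 4 F) =
      (∑ q : Fin n → {q : Fin 4 × Fin 4 // q.1 < q.2},
          ∑ x ∈ Fintype.piFinset (fun k => if (q k).1.1 = 0 then box 4 L
              else (box 4 L).filter (fun y => 1 - (L : ℤ) ≤ y 0)),
            (((lam ^ n * ∫ U, ∏ k, (torusPlaquette r (2 * L + 1) (q k).1.1 (q k).1.2 (x k) U - m (q k))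
                ∂(wilsonMeasure r.ρ β : Measure (GaugeConfig 4 (2 * L + 1) G)) : ℝ) : ℂ)) •
              LabelledSchwingerFamily.evalAt (fun k => a • (siteToE (x k) +
                (2⁻¹ : ℝ) • (EuclideanSpace.single (q k).1.1 (1 : ℝ) + EuclideanSpace.single (q k).1.2 (1 : ℝ)
                  - EuclideanSpace.single 0 (1 : ℝ))))) F := by
  intro G _ _ _ _ _ _ r β L a lam m n F
  simp only [sum_apply, smul_apply,
    LabelledSchwingerFamily.evalAt_apply, thetaMulti_apply, smul_eq_mul]
  refine Finset.sum_congr rfl fun q _ => ?_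
  refine (herm_sum_reindex_corner
    (fun qq : {q : Fin 4 × Fin 4 // q.1 < q.2} =>
      if qq.1.1 = 0 then box 4 L else (box 4 L).filter (fun y => 1 - (L : ℤ) ≤ y 0))
    (fun qq y => if qq.1.1 = 0 then thetaZ y - Pi.single 0 1 else thetaZ y)
    (herm_corner_mem L) (fun qq y _ => herm_corner_inv qq y) q _).trans ?_
  refine Finset.sum_congr rfl fun x _ => ?_
  exact thetaI_summand r β L a lam m F q x

end Summit.QuantumFields.YangMills.Cruxes.HypercubicLimit.ConditionalMeanTelescoping

end
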